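import Literature.NumberTheory.EllipticCurves.Kato2004.IwasawaH1ProjZeroKernelProofs
import Literature.NumberTheory.EllipticCurves.Kato2004.IwasawaCohomologyLevelZero
import Literature.NumberTheory.EllipticCurves.Kato2004.H1TateModuleNoPTorsionProofs
import Literature.NumberTheory.EllipticCurves.Kato2004.IwasawaH1LambdaTorsionFreeProofs
import Literature.NumberTheory.EllipticCurves.Kato2004.IwasawaH1RankLeOneProofs
import Literature.NumberTheory.EllipticCurves.IwasawaAlgebraFreeOfCoinvariantsProofs
import Literature.NumberTheory.EllipticCurves.Kato2004.IwasawaH1ZetaQuotientMuProofs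
import HarnessLib

/-!
# Kato Thm. 12.4 (3) for the pinned `𝐇¹_Γ(T_pW)` at EVERY prime `p`: `𝐇¹_Γ(T_pW)` is a FREE `Λ`-module when `W(ℚ)[p] = 0`
# (in particular when `W[p]` is irreducible) — proofs only

Topic `NumberTheory/EllipticCurves/Kato2004` (namespace = path). THEOREMS ONLY (no definition, no named fact, no `sorry`, no instance).
Written by the width seat `cruxlead-stmt-BirchSwinnertonDyer-19573-w3` g7 (cell `pub/bsd-2adic`) for the `Δ < 0` cell of crux `OrdKatoHalfAtTwoIso`
(`Summits/BirchSwinnertonDyer`, item 19573, child 24097), but NOTHING here is specific to any summit or to `p = 2`.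

WHAT. Kato, Astérisque 295, Thm. 12.4 (3) (p. 221): «If `p ≠ 2` and `T/𝔪_λT` is irreducible as a two dimensional representation of
`Gal(ℚ̄/ℚ)` over `O_λ/𝔪_λ`, `𝐇¹(T)` is a free `Λ`-module of rank 1», proved in §13.8 (pp. 228–229) by showing that a system of parameters
`(x, y)` of (each component of) `Λ = O_λ[[G_∞]]` is a REGULAR SEQUENCE on `𝐇¹(T)`: `x` is injective (torsion-freeness, Thm. 12.4 (2)) and `y` is
injective on `𝐇¹(T)/x𝐇¹(T) ⊂ H¹(ℤ[1/p], T ⊗ Λ/x)` because `H⁰(ℤ[1/p], T ⊗ Λ/(x, y)) = 0` («By the assumption of irreducibility, the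
`Gal(ℚ̄/ℚ)`-fixed part of `(T/𝔪_λT)(r)` is trivial»). The proviso `p ≠ 2` enters only through the structure of the FULL group ring
`O_λ[[ℤ_p^×]]` (at `p = 2`, `Δ = {±1}` has order `2` and `ℤ₂[[ℤ₂^×]]` is not a product of regular local rings). For the tree's PINNED module
`I : IwasawaH1Data W p κ γ` — the `Δ`-TRIVIAL component `𝐇¹_Γ(T_pW) = lim←_n H¹(ℤ_n[1/p], T_pW)` along the cyclotomic `ℤ_p`-extension, a module
over the regular local ring `Λ = ℤ_p⟦X⟧` — the same argument runs at EVERY `p` with the regular sequence `(X, p)`: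
* `X` is injective on `𝐇¹_Γ` (tree THEOREM `IwasawaH1Data.noZeroSMulDivisors`, every `p`);
* `𝐇¹_Γ/X𝐇¹_Γ ↪ H¹(Γ_ℚ, T_pW)` is Kato's (14.14.1), a tree THEOREM (`mem_TSubmodule_of_proj_zero_eq_zero`, w. `proj_zero_eq_zero_of_mem_TSubmodule`);
* `p` is injective on `H¹(Γ_ℚ, T_pW)` when `W(ℚ)[p] = 0` — the tree THEOREM `eq_zero_of_prime_smul_eq_zero_of_forall_fixed` (low end of the
  cohomology sequence of `0 → T_pW → T_pW → W[p] → 0`; here `(T/pT)(r) = W[p]` untwisted since `Λ/(X, p) = 𝔽_p` carries the trivial action);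
* a finitely generated `X`-torsion-free `Λ`-module whose coinvariants `M/XM` are `ℤ_p`-free is `Λ`-free — the tree THEOREM
  `IwasawaAlgebra.free_of_coinvariants'` (Nakayama + `X`-adic division; Bourbaki AC II §3 no. 2 Prop. 5), fed with a `ℤ_p`-basis of the image
  `proj₀(𝐇¹_Γ) ⊂ H¹(Γ_ℚ, T_pW)` (finitely generated and torsion-free over the PID `ℤ_p`, hence free: Mathlib `Module.basisOfFiniteTypeTorsionFree'`).
So: **`IwasawaH1Data.moduleFree_of_torsionBy_eq_bot` — for every elliptic `W/ℚ`, every prime `p` with `W(ℚ)[p] = 0`, the cyclotomic `κ`, a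
topological generator `γ`, and every pinned `I`, the `Λ`-module `I.H = 𝐇¹_Γ(T_pW)` is FREE** (of rank `1` by Thm. 12.4 (2): `thm12_4`, or
`rank_eq_one_of_rank_integralH1_le_one`; with the rank, `exists_generator_of_moduleFree_of_rank_eq_one` gives `𝐇¹_Γ = Λ·e`). At `p = 2` this is
the clause print states only for `p ≠ 2`; the hypothesis `W(ℚ)[2] = 0` holds whenever `ρ̄_{W,2}` is irreducible (no rational `2`-torsion).
Consequence (§4): on the pinned `𝐇¹_Γ(T_pW)` with `W[p]` irreducible, and granted the RANK clause of Thm. 12.4 (2) (`thm12_4`, print, every `p`),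
**`μ(𝐇¹_Γ ⧸ Λz) = 0 ⟺ z ∉ p·𝐇¹_Γ`** (`IwasawaH1Data.moduleFinite_quotient_span_iff_not_mem_smul_top`; ⇒ = `IwasawaH1ZetaQuotientMuProofs` §3, ⇐ = freeness
+ Weierstrass via `moduleFinite_quotient_span_of_generator_of_not_mem_augIdealP_smul_top`).
§5 (appended): the conclusion of `thm12_4`'s clause (3) — `Module.Free ∧ finrank = 1` — at every `p`, from clause (2) and `W(ℚ)[p] = 0`.
HONEST FRAMING: unconditional theorems about the tree's pinned objects; nothing about BSD; Kato's Thm. 12.4 (3) for the FULL `O_λ[[G_∞]]`-module and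
general lattices / newforms is NOT addressed. -- TODO(general form): arbitrary lattices `T ⊂ V_{F_λ}(f)`, the full `Λ = O_λ[[G_∞]]`.

References: [Kato2004Asterisque] Thm. 12.4 (2)(3) (p. 221), §13.8 (pp. 228–229), §14.14 (14.14.1) (p. 243); [BourbakiAC5to7] Ch. II §3 no. 2 Prop. 5;
[Washington1997] §13.3 Lemma 13.16. Tree: `IwasawaAlgebraFreeOfCoinvariantsProofs.lean`, `Kato2004/IwasawaH1ProjZeroKernelProofs.lean` (14.14.1),
`Kato2004/IwasawaCohomologyLevelZero.lean`, `Kato2004/H1TateModuleNoPTorsionProofs.lean`, `Kato2004/IwasawaH1LambdaTorsionFreeProofs.lean`.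
-/

set_option autoImplicit false

noncomputable section

open scoped Classical NumberField
open Field IsDedekindDomain WeierstrassCurve
open Literature.NumberTheory.GaloisRepresentations
open Literature.NumberTheory.EllipticCurves
open Literature.NumberTheory.EllipticCurves.Kato2004.EulerSystemValues
open Literature.NumberTheory.EllipticCurves.IwasawaAlgebra
open WeierstrassCurve (geomPoints geomTorsion)

namespace Literature.NumberTheory.EllipticCurves.Kato2004

variable {W : WeierstrassCurve ℚ} [W.IsElliptic] {p : ℕ} [Fact p.Prime]
  [ContinuousSMul ℤ_[p] (W.tateModule p)] {κ : ZpExtension ℚ p} {γ : absoluteGaloisGroup ℚ}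

/-! ## §1 The bottom layer: `H¹(Γ_ℚ, T_pW)` (at `κ.layerSubgroup 0`) has no `p`-torsion when `W(ℚ)[p] = 0` -/

/-- **`p • x = 0 ⟹ x = 0` in `H¹(κ.layerSubgroup 0, T_pW)` when `W(ℚ)[p] = 0`.**  The bottom layer subgroup is all of `Γ_ℚ`
(`ZpExtension.mem_layerSubgroup_zero`), so a point of `W[p]` fixed by it is rational, hence `0`; then the tree's
`eq_zero_of_prime_smul_eq_zero_of_forall_fixed` (the cohomology sequence of `0 → T_pW → T_pW → W[p] → 0`) applies. (The tree's
`eq_zero_of_prime_smul_eq_zero_of_torsionBy_eq_bot` is the same statement over the subgroup `⊤`; here it is re-run over `layerSubgroup 0`.)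
[cite: Kato2004Asterisque, §13.8 (pp. 228–229) and Thm. 12.4 (2) (p. 221)] -/
theorem eq_zero_of_prime_smul_eq_zero_layerZero (W : WeierstrassCurve ℚ) [W.IsElliptic] (p : ℕ) [Fact p.Prime]
    [ContinuousSMul ℤ_[p] (W.tateModule p)] (κ : ZpExtension ℚ p)
    (hK : AddSubgroup.torsionBy W.toAffine.Point (p : ℤ) = ⊥)
    (x : H1 (tateRep W p) (κ.layerSubgroup 0)) (hx : (p : ℤ_[p]) • x = 0) : x = 0 := by
  refine eq_zero_of_prime_smul_eq_zero_of_forall_fixed W p (κ.layerSubgroup 0) ?_ x hx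
  intro v hv hfixv
  have hfixQ : ∀ σ : absoluteGaloisGroup ℚ, σ • v = v := fun σ ↦ hfixv ⟨σ, κ.mem_layerSubgroup_zero σ⟩
  have hpv : p • v = 0 := AddSubgroup.torsionBy.nsmul_iff.mp hv
  have hmem : v ∈ WeierstrassCurve.geomPrimaryTorsion W p :=
    (AddCommGroup.mem_primaryComponent).mpr ⟨1, by rw [pow_one]; exact hpv⟩
  let a : ↥(WeierstrassCurve.geomPrimaryTorsion W p) := ⟨v, hmem⟩
  have ha : ∀ σ : absoluteGaloisGroup ℚ, σ • a = a := fun σ ↦ by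
    apply Subtype.ext
    rw [primaryComponent.coe_smul]
    exact hfixQ σ
  have h0 : a = 0 := by
    refine W.geomPrimaryTorsion_eq_zero_of_forall_smul_eq p ?_ a ha
    convert hK using 6
  exact congrArg Subtype.val h0

/-- **`H¹(κ.layerSubgroup 0, T_pW)` is `ℤ_p`-torsion-free when `W(ℚ)[p] = 0`**: `c • x = 0` with `c ≠ 0` forces `x = 0` (write
`c = u · p^n` with `u ∈ ℤ_pˣ`, `PadicInt.unitCoeff_spec`, and cancel `p` `n` times). [cite: Kato2004Asterisque, Thm. 12.4 (2) (p. 221)] -/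
theorem isTorsionFree_H1_layerZero (W : WeierstrassCurve ℚ) [W.IsElliptic] (p : ℕ) [Fact p.Prime]
    [ContinuousSMul ℤ_[p] (W.tateModule p)] (κ : ZpExtension ℚ p)
    (hK : AddSubgroup.torsionBy W.toAffine.Point (p : ℤ) = ⊥) :
    Module.IsTorsionFree ℤ_[p] (H1 (tateRep W p) (κ.layerSubgroup 0)) := by
  refine Module.IsTorsionFree.of_smul_eq_zero fun c x hcx => ?_
  by_cases hc : c = 0
  · exact Or.inl hc
  · right
    have hpk : ∀ (k : ℕ) (y : H1 (tateRep W p) (κ.layerSubgroup 0)), ((p : ℤ_[p]) ^ k) • y = 0 → y = 0 := by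
      intro k
      induction k with
      | zero => intro y hy; simpa using hy
      | succ k ih =>
        intro y hy
        apply ih
        apply eq_zero_of_prime_smul_eq_zero_layerZero W p κ hK
        rw [smul_smul, ← pow_succ', hy]
    have hu := PadicInt.unitCoeff_spec hc
    apply hpk c.valuation
    have : ((PadicInt.unitCoeff hc : ℤ_[p]) * (p : ℤ_[p]) ^ c.valuation) • x = 0 := by rw [← hu]; exact hcx
    rw [mul_smul] at this
    exact (smul_eq_zero_iff_eq (PadicInt.unitCoeff hc)).mp (by rw [Units.smul_def]; exact this)

/-! ## §2 Freeness (the tree's `IwasawaH1Data.proj_zero_smul`: `proj₀ (f • x) = f(0) • proj₀ x`) -/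


/-- **Kato Thm. 12.4 (3) at EVERY `p` for the pinned `𝐇¹_Γ(T_pW)`: if `W(ℚ)[p] = 0` then `I.H` is a FREE `Λ`-module.**
Proof (Kato §13.8 for the `Δ`-trivial component, regular sequence `(X, p)`): the image `P = proj₀(𝐇¹_Γ) ⊂ H¹(Γ_ℚ, T_pW)` is a finitely
generated (`IwasawaH1Data.proj_zero_smul` + (12.2.1) `module_finite_of_isCyclotomic`) torsion-free (§1) `ℤ_p`-module, hence free with a finite basis
(`Module.basisOfFiniteTypeTorsionFree'`); lifts of that basis to `𝐇¹_Γ` span modulo `X·𝐇¹_Γ` and are `ℤ_p`-independent modulo `X·𝐇¹_Γ`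
by (14.14.1) (`mem_TSubmodule_of_proj_zero_eq_zero` / `proj_zero_eq_zero_of_mem_TSubmodule`), so they form a `Λ`-basis
(`IwasawaAlgebra.free_of_coinvariants'`, `X`-torsion-freeness from `IwasawaH1Data.noZeroSMulDivisors`).
[cite: Kato2004Asterisque, Thm. 12.4 (3) (p. 221), §13.8 (pp. 228–229), §14.14 (14.14.1) (p. 243)] [cite: BourbakiAC5to7, Ch. II §3 no. 2 Prop. 5] -/
theorem IwasawaH1Data.moduleFree_of_torsionBy_eq_bot (hκ : κ.IsCyclotomic) (hγ : κ.IsTopGenerator γ)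
    (I : IwasawaH1Data W p κ γ) (hK : AddSubgroup.torsionBy W.toAffine.Point (p : ℤ) = ⊥) :
    Module.Free (IwasawaAlgebra p) I.H := by
  classical
  haveI hfinI : Module.Finite (IwasawaAlgebra p) I.H := IwasawaH1Data.module_finite_of_isCyclotomic hκ hγ I
  haveI := I.noZeroSMulDivisors hγ
  haveI := isTorsionFree_H1_layerZero W p κ hK
  -- the image of `proj₀` as a `ℤ_p`-submodule of `H¹(Γ_ℚ, T_pW)`
  let P : Submodule ℤ_[p] (H1 (tateRep W p) (κ.layerSubgroup 0)) :=
    { carrier := Set.range (I.proj 0)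
      add_mem' := by
        rintro _ _ ⟨a, rfl⟩ ⟨b, rfl⟩
        exact ⟨a + b, map_add _ _ _⟩
      zero_mem' := ⟨0, map_zero _⟩
      smul_mem' := by
        rintro c _ ⟨a, rfl⟩
        exact ⟨PowerSeries.C c • a, I.proj_C_smul c 0 a⟩ }
  have hPmem : ∀ x : I.H, I.proj 0 x ∈ P := fun x => ⟨x, rfl⟩
  -- `P` is finitely generated over `ℤ_p`
  obtain ⟨G, hG⟩ := Module.Finite.fg_top (R := IwasawaAlgebra p) (M := I.H)
  have hPspan : P = Submodule.span ℤ_[p] ((fun g => I.proj 0 g) '' (G : Set I.H)) := by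
    apply le_antisymm
    · rintro _ ⟨x, rfl⟩
      have hx : x ∈ Submodule.span (IwasawaAlgebra p) (G : Set I.H) := by rw [hG]; exact Submodule.mem_top
      induction hx using Submodule.span_induction with
      | mem g hg => exact Submodule.subset_span ⟨g, hg, rfl⟩
      | zero => rw [map_zero]; exact Submodule.zero_mem _
      | add a b _ _ ha hb => rw [map_add]; exact Submodule.add_mem _ ha hb
      | smul f a _ ha => rw [I.proj_zero_smul]; exact Submodule.smul_mem _ _ ha
    · rw [Submodule.span_le]
      rintro _ ⟨g, -, rfl⟩
      exact hPmem g
  haveI : Module.Finite ℤ_[p] P := by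
    rw [Module.Finite.iff_fg, hPspan]
    exact Submodule.fg_span ((G.finite_toSet).image _)
  -- `P` is torsion-free, hence free over the PID `ℤ_p`, with a finite basis
  haveI : Module.IsTorsionFree ℤ_[p] P := inferInstance
  obtain ⟨n, b⟩ := Module.basisOfFiniteTypeTorsionFree' (R := ℤ_[p]) (M := P)
  -- lift the basis
  have hsurj : ∀ i : Fin n, ∃ x : I.H, I.proj 0 x = (b i : H1 (tateRep W p) (κ.layerSubgroup 0)) :=
    fun i => (b i).2
  choose s hs using hsurj
  have hsum : ∀ c : Fin n → ℤ_[p],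
      I.proj 0 (∑ i, (PowerSeries.C (c i) : IwasawaAlgebra p) • s i) = ((∑ i, c i • b i : P) : H1 (tateRep W p) (κ.layerSubgroup 0)) := by
    intro c
    rw [map_sum, Submodule.coe_sum]
    refine Finset.sum_congr rfl fun i _ => ?_
    rw [I.proj_C_smul, hs, Submodule.coe_smul]
  refine IwasawaAlgebra.free_of_coinvariants' s ?_ ?_
  · -- spanning modulo `X·𝐇¹_Γ`
    rw [eq_top_iff]
    intro x _
    set c : Fin n → ℤ_[p] := fun i => b.repr ⟨I.proj 0 x, hPmem x⟩ i with hc_def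
    have hrepr : (∑ i, c i • b i : P) = ⟨I.proj 0 x, hPmem x⟩ := b.sum_repr _
    have hx0 : I.proj 0 (x - ∑ i, (PowerSeries.C (c i) : IwasawaAlgebra p) • s i) = 0 := by
      rw [map_sub, hsum, hrepr, sub_self]
    have hxT : x - ∑ i, (PowerSeries.C (c i) : IwasawaAlgebra p) • s i ∈ TSubmodule p I.H :=
      TwistTate.mem_TSubmodule_of_proj_zero_eq_zero W p κ hκ hγ I _ hx0
    have hxs : ∑ i, (PowerSeries.C (c i) : IwasawaAlgebra p) • s i ∈
        Submodule.span (IwasawaAlgebra p) (Set.range s) :=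
      Submodule.sum_mem _ fun i _ => Submodule.smul_mem _ _ (Submodule.subset_span ⟨i, rfl⟩)
    have : x = (∑ i, (PowerSeries.C (c i) : IwasawaAlgebra p) • s i) +
        (x - ∑ i, (PowerSeries.C (c i) : IwasawaAlgebra p) • s i) := by abel
    rw [this]
    exact Submodule.add_mem_sup hxs hxT
  · -- `ℤ_p`-independence modulo `X·𝐇¹_Γ`
    intro c hc i
    have h0 : I.proj 0 (∑ i, (PowerSeries.C (c i) : IwasawaAlgebra p) • s i) = 0 :=
      I.proj_zero_eq_zero_of_mem_TSubmodule hc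
    rw [hsum] at h0
    have h0' : (∑ i, c i • b i : P) = 0 := Subtype.ext h0
    exact Fintype.linearIndependent_iff.mp b.linearIndependent c h0' i

/-- **`𝐇¹_Γ(T_pW)` is free when `W[p]` is irreducible** (no rational point of order `p`:
`not_exists_addOrderOf_eq_of_hasIrreducibleModPGaloisRep`). [cite: Kato2004Asterisque, Thm. 12.4 (3) (p. 221)] -/
theorem IwasawaH1Data.moduleFree_of_hasIrreducibleModPGaloisRep (hκ : κ.IsCyclotomic) (hγ : κ.IsTopGenerator γ)
    (I : IwasawaH1Data W p κ γ) (hirr : W.HasIrreducibleModPGaloisRep p) :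
    Module.Free (IwasawaAlgebra p) I.H := by
  refine I.moduleFree_of_torsionBy_eq_bot hκ hγ ((AddSubgroup.eq_bot_iff_forall _).mpr fun P hP ↦ ?_)
  have hp : (p : ℕ).Prime := Fact.out
  by_contra hne
  have hnP : p • P = 0 := by
    have := AddSubgroup.torsionBy.nsmul_iff.mp hP
    exact this
  have hord : addOrderOf P = p := by
    have hdvd : addOrderOf P ∣ p := addOrderOf_dvd_of_nsmul_eq_zero hnP
    rcases (Nat.dvd_prime hp).mp hdvd with h1 | h1
    · exact absurd (AddMonoid.addOrderOf_eq_one_iff.mp h1) hne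
    · exact h1
  exact not_exists_addOrderOf_eq_of_hasIrreducibleModPGaloisRep W hirr ⟨P, hord⟩

/-! ## §3 With the rank: free of rank one, and a generator -/

/-- **A free `Λ`-module of rank `1` is cyclic on a torsion-free generator**: `∃ e ≠ 0, ∀ x, ∃ a, x = a • e`.
[cite: Kato2004Asterisque, Thm. 12.4 (3) (p. 221) (shape)] -/
theorem exists_generator_of_moduleFree_of_rank_eq_one {M : Type*} [AddCommGroup M] [Module (IwasawaAlgebra p) M]
    [Module.Free (IwasawaAlgebra p) M] (hrk : Module.rank (IwasawaAlgebra p) M = 1) :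
    ∃ e : M, e ≠ 0 ∧ ∀ x : M, ∃ a : IwasawaAlgebra p, x = a • e := by
  classical
  let ι := Module.Free.ChooseBasisIndex (IwasawaAlgebra p) M
  let b := Module.Free.chooseBasis (IwasawaAlgebra p) M
  have hcard : Cardinal.mk ι = 1 := by
    rw [← Module.Free.rank_eq_card_chooseBasisIndex, hrk]
  haveI : Nonempty ι := Cardinal.mk_ne_zero_iff.mp (by rw [hcard]; exact one_ne_zero)
  haveI hsub : Subsingleton ι := Cardinal.le_one_iff_subsingleton.mp hcard.le
  obtain ⟨i₀⟩ := ‹Nonempty ι›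
  haveI : Fintype ι := Fintype.ofFinite ι
  refine ⟨b i₀, b.ne_zero i₀, fun x => ⟨b.repr x i₀, ?_⟩⟩
  conv_lhs => rw [← b.sum_repr x]
  rw [Fintype.sum_subsingleton _ i₀]

/-- **Kato Thm. 12.4 (2)+(3) for the pinned `𝐇¹_Γ(T_pW)`, every `p`: free of rank ONE with a generator**, granted `W(ℚ)[p] = 0` and the rank
clause of Thm. 12.4 (2) (`thm12_4`, named fact, every `p`): `∃ e ≠ 0, 𝐇¹_Γ = Λ·e`. [cite: Kato2004Asterisque, Thm. 12.4 (2)(3) (p. 221)] -/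
theorem IwasawaH1Data.exists_generator_of_thm12_4_of_torsionBy_eq_bot (h12 : thm12_4) (hκ : κ.IsCyclotomic)
    (hγ : κ.IsTopGenerator γ) (I : IwasawaH1Data W p κ γ) (hK : AddSubgroup.torsionBy W.toAffine.Point (p : ℤ) = ⊥) :
    ∃ e : I.H, e ≠ 0 ∧ ∀ x : I.H, ∃ a : IwasawaAlgebra p, x = a • e := by
  haveI := I.moduleFree_of_torsionBy_eq_bot hκ hγ hK
  obtain ⟨-, ⟨-, hrk⟩, -⟩ := h12 W p κ γ hκ hγ I
  exact exists_generator_of_moduleFree_of_rank_eq_one hrk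

/-- The same from irreducibility of `W[p]` (no rational point of order `p`). [cite: Kato2004Asterisque, Thm. 12.4 (2)(3) (p. 221)] -/
theorem IwasawaH1Data.exists_generator_of_thm12_4_of_hasIrreducibleModPGaloisRep (h12 : thm12_4) (hκ : κ.IsCyclotomic)
    (hγ : κ.IsTopGenerator γ) (I : IwasawaH1Data W p κ γ) (hirr : W.HasIrreducibleModPGaloisRep p) :
    ∃ e : I.H, e ≠ 0 ∧ ∀ x : I.H, ∃ a : IwasawaAlgebra p, x = a • e := by
  haveI := I.moduleFree_of_hasIrreducibleModPGaloisRep hκ hγ hirr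
  obtain ⟨-, ⟨-, hrk⟩, -⟩ := h12 W p κ γ hκ hγ I
  exact exists_generator_of_moduleFree_of_rank_eq_one hrk

/-! ## §4 On a free cyclic module the zeta quotient detects exactly `p`-divisibility: `μ(M ⧸ Λz) = 0 ⟺ z ∉ p·M` -/

/-- **On a torsion-free cyclic `Λ`-module `M = Λ·e`, a class NOT divisible by `p` has a quotient of `μ`-invariant zero**: if `z ∉ (p)·M`
then `M ⧸ Λz` is finitely generated over `ℤ_p`. Indeed `z = β • e` with `β ∉ (p)` (else `z = p • (c • e)`), `M ≃ Λ` (`a ↦ a • e`, bijective by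
torsion-freeness and cyclicity), and `M ⧸ Λz ≅ Λ ⧸ (β)` is finitely generated over `ℤ_p` by Weierstrass preparation
(`moduleFinite_quotient_span_of_notMem_augIdealP`). Converse of `not_moduleFinite_quotient_span_of_mem_augIdealP_smul_top` on free cyclic modules.
[cite: Washington1997, §7.1 Thm. 7.3, §13.2] [cite: Kato2004Asterisque, Thm. 12.4 (3) (p. 221) (shape)] -/
theorem moduleFinite_quotient_span_of_generator_of_not_mem_augIdealP_smul_top {M : Type*} [AddCommGroup M]
    [Module (IwasawaAlgebra p) M] [NoZeroSMulDivisors (IwasawaAlgebra p) M]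
    {e : M} (he : e ≠ 0) (hgen : ∀ x : M, ∃ a : IwasawaAlgebra p, x = a • e) {z : M}
    (hz : z ∉ IwasawaAlgebra.augIdealP p • (⊤ : Submodule (IwasawaAlgebra p) M)) :
    Module.Finite ℤ_[p] (RestrictScalars ℤ_[p] (IwasawaAlgebra p) (M ⧸ (IwasawaAlgebra p) ∙ z)) := by
  -- `M ≃ Λ` through the generator
  have hinj : Function.Injective (LinearMap.toSpanSingleton (IwasawaAlgebra p) M e) :=
    smul_left_injective (IwasawaAlgebra p) he
  have hsurj : Function.Surjective (LinearMap.toSpanSingleton (IwasawaAlgebra p) M e) := by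
    intro x
    obtain ⟨a, rfl⟩ := hgen x
    exact ⟨a, rfl⟩
  let ψ : M ≃ₗ[IwasawaAlgebra p] IwasawaAlgebra p :=
    (LinearEquiv.ofBijective (LinearMap.toSpanSingleton (IwasawaAlgebra p) M e) ⟨hinj, hsurj⟩).symm
  have hψ : ∀ a : IwasawaAlgebra p, ψ (a • e) = a := fun a =>
    (LinearEquiv.symm_apply_eq _).mpr rfl
  obtain ⟨β, hβ⟩ := hgen z
  have hβp : β ∉ IwasawaAlgebra.augIdealP p := by
    intro hmem
    apply hz
    rw [IwasawaAlgebra.augIdealP, Ideal.mem_span_singleton'] at hmem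
    obtain ⟨c, rfl⟩ := hmem
    rw [hβ, mul_comm, mul_smul, IwasawaAlgebra.augIdealP]
    exact Submodule.smul_mem_smul (Ideal.mem_span_singleton_self _) Submodule.mem_top
  have hspan : Submodule.span (IwasawaAlgebra p) ({e} : Set M) = ⊤ :=
    eq_top_iff.mpr fun x _ => by
      obtain ⟨a, rfl⟩ := hgen x
      exact Submodule.smul_mem _ a (Submodule.subset_span rfl)
  have hrk : Module.rank (IwasawaAlgebra p) M ≤ 1 := by
    rw [← rank_top, ← hspan]
    exact (rank_span_le _).trans (by rw [Cardinal.mk_singleton])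
  refine moduleFinite_quotient_span_of_notMem_augIdealP hrk ψ.toLinearMap z ?_
  change ψ z ∉ _
  rwa [hβ, hψ]

/-- **On the pinned `𝐇¹_Γ(T_pW)` with `W[p]` irreducible: `μ(𝐇¹_Γ ⧸ Λz) = 0 ⟺ z ∉ p·𝐇¹_Γ`** (every `p`), granted the rank clause of Kato
Thm. 12.4 (2) (`thm12_4`): ⇒ is `IwasawaH1Data.not_mem_augIdealP_smul_top_of_moduleFinite_quotient_span_of_thm12_4` (torsion-freeness only), ⇐ uses the
FREENESS of §2 (`𝐇¹_Γ = Λ·e`) and Weierstrass preparation. At `p = 2` this identifies the Summits-side memo MU13⁻ («zeta quotient of `μ` zero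
for a genuine class») with N2D⁻ («a genuine class not `2`-divisible»). [cite: Kato2004Asterisque, Thm. 12.4 (2)(3) (p. 221), §13.8 (pp. 228–229)] -/
theorem IwasawaH1Data.moduleFinite_quotient_span_iff_not_mem_smul_top (h12 : thm12_4) (hκ : κ.IsCyclotomic)
    (hγ : κ.IsTopGenerator γ) (I : IwasawaH1Data W p κ γ) (hirr : W.HasIrreducibleModPGaloisRep p) (z : I.H) :
    Module.Finite ℤ_[p] (RestrictScalars ℤ_[p] (IwasawaAlgebra p) (I.H ⧸ (IwasawaAlgebra p) ∙ z)) ↔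
      z ∉ IwasawaAlgebra.augIdealP p • (⊤ : Submodule (IwasawaAlgebra p) I.H) := by
  refine ⟨fun hfin => I.not_mem_augIdealP_smul_top_of_moduleFinite_quotient_span_of_thm12_4 h12 hκ hγ hfin, fun hz => ?_⟩
  haveI := I.noZeroSMulDivisors hγ
  obtain ⟨e, he, hgen⟩ := I.exists_generator_of_thm12_4_of_hasIrreducibleModPGaloisRep h12 hκ hγ hirr
  exact moduleFinite_quotient_span_of_generator_of_not_mem_augIdealP_smul_top he hgen hz

/-! ## §5 (appended) The conclusion of `thm12_4`'s clause (3) WITHOUT its `p ≠ 2` guard -/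

/-- **Kato Thm. 12.4 (3) in the exact shape of the named fact `thm12_4`'s third clause — `Module.Free Λ 𝐇¹_Γ ∧ finrank_Λ 𝐇¹_Γ = 1` — at EVERY `p`
(no `p ≠ 2` guard), from `W(ℚ)[p] = 0` and the rank clause of Thm. 12.4 (2).** So a consumer holding `thm12_4` (for clause (2)) gets clause (3) at
`p = 2` as a theorem whenever `W[2]` is irreducible. [cite: Kato2004Asterisque, Thm. 12.4 (2)(3) (p. 221), §13.8 (pp. 228–229)] -/
theorem IwasawaH1Data.free_and_finrank_eq_one_of_thm12_4_of_torsionBy_eq_bot (h12 : thm12_4) (hκ : κ.IsCyclotomic)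
    (hγ : κ.IsTopGenerator γ) (I : IwasawaH1Data W p κ γ) (hK : AddSubgroup.torsionBy W.toAffine.Point (p : ℤ) = ⊥) :
    Module.Free (IwasawaAlgebra p) I.H ∧ Module.finrank (IwasawaAlgebra p) I.H = 1 := by
  obtain ⟨-, ⟨-, hrk⟩, -⟩ := h12 W p κ γ hκ hγ I
  exact ⟨I.moduleFree_of_torsionBy_eq_bot hκ hγ hK, Module.finrank_eq_of_rank_eq (by rw [hrk, Nat.cast_one])⟩

/-- The same from irreducibility of `W[p]`. [cite: Kato2004Asterisque, Thm. 12.4 (2)(3) (p. 221)] -/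
theorem IwasawaH1Data.free_and_finrank_eq_one_of_thm12_4_of_hasIrreducibleModPGaloisRep (h12 : thm12_4) (hκ : κ.IsCyclotomic)
    (hγ : κ.IsTopGenerator γ) (I : IwasawaH1Data W p κ γ) (hirr : W.HasIrreducibleModPGaloisRep p) :
    Module.Free (IwasawaAlgebra p) I.H ∧ Module.finrank (IwasawaAlgebra p) I.H = 1 := by
  obtain ⟨-, ⟨-, hrk⟩, -⟩ := h12 W p κ γ hκ hγ I
  exact ⟨I.moduleFree_of_hasIrreducibleModPGaloisRep hκ hγ hirr, Module.finrank_eq_of_rank_eq (by rw [hrk, Nat.cast_one])⟩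

/-- **The three clauses of `thm12_4` at a pin WITHOUT the parity guard**, for `W[p]` irreducible: `thm12_4` ⟹ (12.2.1) ∧ (12.4 (2)) ∧ (12.4 (3) at
every `p`). [cite: Kato2004Asterisque, §12.2 (12.2.1) (p. 220), Thm. 12.4 (2)(3) (p. 221)] -/
theorem IwasawaH1Data.thm12_4_clauses_all_primes_of_hasIrreducibleModPGaloisRep (h12 : thm12_4) (hκ : κ.IsCyclotomic)
    (hγ : κ.IsTopGenerator γ) (I : IwasawaH1Data W p κ γ) (hirr : W.HasIrreducibleModPGaloisRep p) :
    Module.Finite (IwasawaAlgebra p) I.H ∧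
      (Module.IsTorsionFree (IwasawaAlgebra p) I.H ∧ Module.rank (IwasawaAlgebra p) I.H = 1) ∧
      (Module.Free (IwasawaAlgebra p) I.H ∧ Module.finrank (IwasawaAlgebra p) I.H = 1) := by
  obtain ⟨hfin, h2, -⟩ := h12 W p κ γ hκ hγ I
  exact ⟨hfin, h2, I.free_and_finrank_eq_one_of_thm12_4_of_hasIrreducibleModPGaloisRep h12 hκ hγ hirr⟩

end Literature.NumberTheory.EllipticCurves.Kato2004

end
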